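import Summits.AtomisticToContinuum.HydrodynamicLimit.Theorems.CollisionIsometryCLTAdaptedWeightCLTCBFreeStretch
import Summits.AtomisticToContinuum.HydrodynamicLimit.Theorems.CollisionIsometryCLTAdaptedWeightCLTTLPastDampingWindows

/-!
# Stub `stub_tailsVmax` of the line `Sketch` (contact-balance composition) for the crux
`AdaptedWeightCLT` (stmt-AtomisticToContinuum-14868; `--supports`)

H2 CONTROLS THE TIME-INTEGRATED MAXIMAL SPEED. `TailsOn σ a₀ θ₀ u₀ Φ t` (there are `λ > 0` and `C_exp`
with `P_N{C_exp < ∫₀ᵗ M_λ(Φ_s z) ds} → 0`, `M_λ(w) = (N+1)⁻¹ Σ_i e^{λ|v_i|²} = expMoment λ N w`) gives, for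
every `p > 0`, `P_N{(N+1)^p < ∫₀ᵗ (1 + v_max(Φ_s z))⁸ ds} → 0`:
* POINTWISE (any configuration): `e^{λ v_max²} ≤ Σ_i e^{λ|v_i|²} = (N+1) M_λ` (the max is attained),
  `x⁴ ≤ 4!/μ⁴ · e^{μ x}` with `x = v_max²`, `μ = λ q`, and `e^{λ q v_max²} = (e^{λ v_max²})^q ≤ (N+1)^q M_λ^q
  ≤ (N+1)^q M_λ` (`M_λ ≥ 1`, `0 < q ≤ 1`); with `(1 + v)⁸ ≤ 2⁷ (1 + v⁸)`:
  `(1 + v_max)⁸ ≤ 128 + 128 · 24/(λq)⁴ · (N+1)^q · M_λ`;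
* ALONG A GOOD ORBIT `s ↦ M_λ(Φ_s z)` is integrable on `[0, t]` (landed
  `PastDamping.integrableOn_expMoment_flow`), so `∫₀ᵗ (1 + v_max)⁸ ≤ 128 t + B_q (N+1)^q ∫₀ᵗ M_λ`
  (`integral_mono_of_nonneg`: no integrability of the left integrand is needed);
* PROBABILITY: with `q = min 1 (p/2) < p`, off the H2 event and on the good set
  `∫₀ᵗ (1 + v_max)⁸ ≤ (128 t + B_q C_exp⁺) (N+1)^q < (N+1)^p` eventually in `N`; the good set carries the
  local Gibbs law; squeeze.
-/

namespace Summit.AtomisticToContinuum.HydrodynamicLimit.Theorems.ContactBalance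

open scoped BigOperators Topology Classical MeasureTheory ENNReal InnerProductSpace
open Filter Set MeasureTheory
open Literature.Analysis.FluidPDE
open Summit.AtomisticToContinuum.HydrodynamicLimit.Theorems.ContactSourceDuhamel
open Summit.AtomisticToContinuum.HydrodynamicLimit.Theorems.ContactSourceDuhamel.TimeLocal
open Literature.MathematicalPhysics.KineticTheory (hsDiameter localGibbsLaw localGibbsLaw_absolutelyContinuous)

noncomputable section

namespace TailsVmax

/-! ## Pointwise: the maximal speed against the exponential moment -/

/-- `x⁴ ≤ 24/μ⁴ · e^{μ x}` for `x ≥ 0`, `μ > 0` (`(μx)⁴/4! ≤ e^{μx}`). -/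
theorem pow_four_le_exp {x μ : ℝ} (hx : 0 ≤ x) (hμ : 0 < μ) :
    x ^ 4 ≤ 24 / μ ^ 4 * Real.exp (μ * x) := by
  have h := Real.pow_div_factorial_le_exp (x := μ * x) (by positivity) 4
  have h4 : ((Nat.factorial 4 : ℕ) : ℝ) = 24 := by norm_num [Nat.factorial]
  rw [h4, mul_pow, div_le_iff₀ (by norm_num : (0 : ℝ) < 24)] at h
  have hμ4 : 0 < μ ^ 4 := by positivity
  rw [div_mul_eq_mul_div, le_div_iff₀ hμ4]
  calc x ^ 4 * μ ^ 4 = μ ^ 4 * x ^ 4 := mul_comm _ _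
    _ ≤ Real.exp (μ * x) * 24 := h
    _ = 24 * Real.exp (μ * x) := mul_comm _ _

/-- `0 ≤ v_max`. -/
theorem vmax_nonneg (N : ℕ) (w : Cfg N) : 0 ≤ vmax N w :=
  (norm_nonneg _).trans (Finset.le_sup' (fun i => ‖(w i).2‖) (Finset.mem_univ 0))

/-- `1 ≤ expMoment λ N w` for `λ ≥ 0` (each summand is at least `1`). -/
theorem one_le_expMoment {lam : ℝ} (hlam : 0 ≤ lam) (N : ℕ) (w : Cfg N) :
    1 ≤ PastDamping.expMoment lam N w := by
  unfold PastDamping.expMoment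
  have hN : (0 : ℝ) < ((N + 1 : ℕ) : ℝ) := by positivity
  rw [le_inv_mul_iff₀ hN, mul_one]
  calc ((N + 1 : ℕ) : ℝ) = ∑ _i : Fin (N + 1), (1 : ℝ) := by simp
    _ ≤ ∑ i, Real.exp (lam * ‖(w i).2‖ ^ 2) :=
        Finset.sum_le_sum fun i _ => Real.one_le_exp (by positivity)

/-- The maximal speed against the exponential moment: `e^{λ v_max²} ≤ (N+1) · expMoment λ N w`
(the maximum is attained at some particle). -/
theorem exp_vmax_le (lam : ℝ) (N : ℕ) (w : Cfg N) :
    Real.exp (lam * vmax N w ^ 2) ≤ ((N + 1 : ℕ) : ℝ) * PastDamping.expMoment lam N w := by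
  obtain ⟨i, -, hi⟩ := Finset.exists_mem_eq_sup' Finset.univ_nonempty fun i : Fin (N + 1) => ‖(w i).2‖
  have hN : (0 : ℝ) < ((N + 1 : ℕ) : ℝ) := by positivity
  unfold PastDamping.expMoment
  rw [← mul_assoc, mul_inv_cancel₀ hN.ne', one_mul]
  unfold vmax
  rw [hi]
  exact Finset.single_le_sum (f := fun j => Real.exp (lam * ‖(w j).2‖ ^ 2))
    (fun j _ => (Real.exp_pos _).le) (Finset.mem_univ i)

/-- `v_max⁸ ≤ 24/(λq)⁴ · (N+1)^q · expMoment λ N w` for `λ > 0`, `0 < q ≤ 1`. -/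
theorem vmax_pow_eight_le {lam q : ℝ} (hlam : 0 < lam) (hq : 0 < q) (hq1 : q ≤ 1) (N : ℕ) (w : Cfg N) :
    vmax N w ^ 8 ≤ 24 / (lam * q) ^ 4 * (((N + 1 : ℕ) : ℝ) ^ q * PastDamping.expMoment lam N w) := by
  have hV0 : 0 ≤ vmax N w := vmax_nonneg N w
  have hN : (0 : ℝ) < ((N + 1 : ℕ) : ℝ) := by positivity
  have hE1 : 1 ≤ PastDamping.expMoment lam N w := one_le_expMoment hlam.le N w
  have hμ : 0 < lam * q := mul_pos hlam hq
  have h1 : vmax N w ^ 8 ≤ 24 / (lam * q) ^ 4 * Real.exp (lam * q * vmax N w ^ 2) := by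
    have h := pow_four_le_exp (x := vmax N w ^ 2) (by positivity) hμ
    have h8 : vmax N w ^ 8 = (vmax N w ^ 2) ^ 4 := by ring
    rw [h8]
    exact h
  have h2 : Real.exp (lam * q * vmax N w ^ 2) ≤ ((N + 1 : ℕ) : ℝ) ^ q * PastDamping.expMoment lam N w := by
    have he : Real.exp (lam * q * vmax N w ^ 2) = Real.exp (lam * vmax N w ^ 2) ^ q := by
      rw [← Real.exp_mul]; congr 1; ring
    rw [he]
    calc Real.exp (lam * vmax N w ^ 2) ^ q ≤ (((N + 1 : ℕ) : ℝ) * PastDamping.expMoment lam N w) ^ q :=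
          Real.rpow_le_rpow (Real.exp_pos _).le (exp_vmax_le lam N w) hq.le
      _ = ((N + 1 : ℕ) : ℝ) ^ q * PastDamping.expMoment lam N w ^ q :=
          Real.mul_rpow hN.le (by linarith)
      _ ≤ ((N + 1 : ℕ) : ℝ) ^ q * PastDamping.expMoment lam N w := by
          refine mul_le_mul_of_nonneg_left ?_ (Real.rpow_nonneg hN.le q)
          calc PastDamping.expMoment lam N w ^ q ≤ PastDamping.expMoment lam N w ^ (1 : ℝ) :=
                Real.rpow_le_rpow_of_exponent_le hE1 hq1
            _ = PastDamping.expMoment lam N w := Real.rpow_one _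
  calc vmax N w ^ 8 ≤ 24 / (lam * q) ^ 4 * Real.exp (lam * q * vmax N w ^ 2) := h1
    _ ≤ 24 / (lam * q) ^ 4 * (((N + 1 : ℕ) : ℝ) ^ q * PastDamping.expMoment lam N w) :=
        mul_le_mul_of_nonneg_left h2 (by positivity)

/-- POINTWISE BOUND: `(1 + v_max)⁸ ≤ 128 + B_q (N+1)^q · expMoment λ N w` (`(1+v)⁸ ≤ 2⁷(1 + v⁸)`). -/
theorem one_add_vmax_pow_le {lam q : ℝ} (hlam : 0 < lam) (hq : 0 < q) (hq1 : q ≤ 1) (N : ℕ)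
    (w : Cfg N) :
    (1 + vmax N w) ^ 8 ≤
      128 + 128 * (24 / (lam * q) ^ 4) * ((N + 1 : ℕ) : ℝ) ^ q * PastDamping.expMoment lam N w := by
  have hV0 : 0 ≤ vmax N w := vmax_nonneg N w
  have h1 : (1 + vmax N w) ^ 8 ≤ 2 ^ (8 - 1) * (1 ^ 8 + vmax N w ^ 8) := add_pow_le zero_le_one hV0 8
  have h2 := vmax_pow_eight_le hlam hq hq1 N w
  have h3 : (2 : ℝ) ^ (8 - 1) * (1 ^ 8 + vmax N w ^ 8) = 128 + 128 * vmax N w ^ 8 := by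
    norm_num
    ring
  rw [h3] at h1
  have h4 : 128 * vmax N w ^ 8 ≤
      128 * (24 / (lam * q) ^ 4) * ((N + 1 : ℕ) : ℝ) ^ q * PastDamping.expMoment lam N w := by
    have := mul_le_mul_of_nonneg_left h2 (by norm_num : (0 : ℝ) ≤ 128)
    calc 128 * vmax N w ^ 8 ≤ 128 * (24 / (lam * q) ^ 4 * (((N + 1 : ℕ) : ℝ) ^ q *
          PastDamping.expMoment lam N w)) := this
      _ = 128 * (24 / (lam * q) ^ 4) * ((N + 1 : ℕ) : ℝ) ^ q * PastDamping.expMoment lam N w := by ring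
  linarith

/-! ## Along a good orbit -/

/-- ORBIT BOUND: on a good orbit, `∫₀ᵗ (1 + v_max)⁸ ≤ 128 t + B_q (N+1)^q ∫₀ᵗ expMoment λ N (Φ_s z) ds`
(the right integrand is integrable on the horizon, the left one is nonnegative). -/
theorem vmaxInt_le {σ : ℝ} {N : ℕ} {lam q : ℝ} (hlam : 0 < lam) (hq : 0 < q) (hq1 : q ≤ 1)
    (Φ : Flow σ N) {z : Cfg N} (hz : z ∈ Φ.good) {t : ℝ} (ht : 0 ≤ t) :
    vmaxInt σ N Φ t z ≤ 128 * t + 128 * (24 / (lam * q) ^ 4) * ((N + 1 : ℕ) : ℝ) ^ q *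
      ∫ s in Icc 0 t, PastDamping.expMoment lam N (Φ.flow s z) := by
  unfold vmaxInt
  set K : ℝ := 128 * (24 / (lam * q) ^ 4) * ((N + 1 : ℕ) : ℝ) ^ q with hK
  have hI := PastDamping.integrableOn_expMoment_flow hlam.le Φ hz 0 t
  have hKI : IntegrableOn (fun s => K * PastDamping.expMoment lam N (Φ.flow s z)) (Icc 0 t) :=
    hI.const_mul K
  have hcI : IntegrableOn (fun _ : ℝ => (128 : ℝ)) (Icc 0 t) := integrableOn_const measure_Icc_lt_top.ne
  have hgI : IntegrableOn (fun s => (128 : ℝ) + K * PastDamping.expMoment lam N (Φ.flow s z)) (Icc 0 t) :=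
    hcI.add hKI
  have h0 : 0 ≤ᵐ[volume.restrict (Icc 0 t)] fun s => (1 + vmax N (Φ.flow s z)) ^ 8 :=
    ae_of_all _ fun s => pow_nonneg (add_nonneg zero_le_one (vmax_nonneg N _)) 8
  have hle : (fun s => (1 + vmax N (Φ.flow s z)) ^ 8) ≤ᵐ[volume.restrict (Icc 0 t)]
      fun s => (128 : ℝ) + K * PastDamping.expMoment lam N (Φ.flow s z) :=
    ae_of_all _ fun s => by
      have h := one_add_vmax_pow_le hlam hq hq1 N (Φ.flow s z)
      rw [hK]
      exact h
  have hmono := integral_mono_of_nonneg h0 hgI hle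
  have hconst : ∫ _s in Icc 0 t, (128 : ℝ) = 128 * t := by
    rw [setIntegral_const, smul_eq_mul, measureReal_def, Real.volume_Icc, sub_zero,
      ENNReal.toReal_ofReal ht, mul_comm]
  calc ∫ s in Icc 0 t, (1 + vmax N (Φ.flow s z)) ^ 8
      ≤ ∫ s in Icc 0 t, ((128 : ℝ) + K * PastDamping.expMoment lam N (Φ.flow s z)) := hmono
    _ = (∫ _s in Icc 0 t, (128 : ℝ)) + ∫ s in Icc 0 t, K * PastDamping.expMoment lam N (Φ.flow s z) :=
        integral_add hcI hKI
    _ = 128 * t + K * ∫ s in Icc 0 t, PastDamping.expMoment lam N (Φ.flow s z) := by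
        rw [hconst, integral_const_mul]

/-- Positive powers of `N + 1` tend to infinity. -/
theorem tendsto_natSucc_rpow_atTop {e : ℝ} (he : 0 < e) :
    Tendsto (fun N : ℕ => ((N + 1 : ℕ) : ℝ) ^ e) atTop atTop := by
  have hcast : Tendsto (fun N : ℕ => ((N + 1 : ℕ) : ℝ)) atTop atTop :=
    tendsto_natCast_atTop_atTop.comp (tendsto_add_atTop_nat 1)
  exact (tendsto_rpow_atTop he).comp hcast

end TailsVmax

/-- STUB 6 (H2 controls the time-integrated maximal speed). `TailsOn … t` gives, for every `p > 0`,
`P_N{(N+1)^p < ∫₀ᵗ (1 + v_max(Φ_s z))⁸ ds} → 0`: pointwise `e^{λ v_max²} ≤ (N+1) M_λ(s)`,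
`M_λ(s) = ∫ e^{λ|v|²} dμ_s ≥ 1`, `v_max⁸ ≤ 4!/(λq)⁴ e^{λ q v_max²} ≤ 4!/(λq)⁴ (N+1)^q M_λ(s)` (`0 < q ≤ 1`), so
`(1 + v_max)⁸ ≤ 2⁷(1 + v_max⁸) ≤ 128 + B_q (N+1)^q M_λ(s)`, whence on good orbits
`∫₀ᵗ (1+v_max)⁸ ≤ 128 t + B_q (N+1)^q ∫₀ᵗ M_λ ≤ (N+1)^p` eventually on the complement of the H2 event
`{C_exp < ∫₀ᵗ M_λ}` (`q = min 1 (p/2)`); the good set carries the local Gibbs law. -/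
theorem stub_tailsVmax : ∀ (a₀ θ₀ : T3 → ℝ) (u₀ : T3 → V3), NiceProfiles a₀ θ₀ u₀ →
    ∀ σ : ℝ, 0 < σ → σ < 2⁻¹ → ∀ (Φ : Flows σ) (t : ℝ), 0 < t → TailsOn σ a₀ θ₀ u₀ Φ t →
      ∀ p : ℝ, 0 < p →
        Tendsto (fun N : ℕ => localGibbsLaw σ a₀ u₀ θ₀ N (Φ N)
          {z | ((N + 1 : ℕ) : ℝ) ^ p < vmaxInt σ N (Φ N) t z}) atTop (𝓝 0) := by
  intro a₀ θ₀ u₀ _hnice σ _hσ _hσ2 Φ t ht hT p hp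
  obtain ⟨lam, Cexp, hlam, hH2⟩ := hT
  -- the auxiliary exponent `q = min 1 (p/2)`, `0 < q ≤ 1`, `q < p`
  set q : ℝ := min 1 (p / 2) with hq_def
  have hq : 0 < q := lt_min one_pos (half_pos hp)
  have hq1 : q ≤ 1 := min_le_left _ _
  have hpq : 0 < p - q := by
    have : q ≤ p / 2 := min_le_right _ _
    linarith
  set B : ℝ := 128 * (24 / (lam * q) ^ 4) with hB_def
  have hB : 0 ≤ B := by rw [hB_def]; positivity
  set M : ℝ := 128 * t + B * max Cexp 0 with hM_def
  have hpos : ∀ N : ℕ, (0 : ℝ) < ((N + 1 : ℕ) : ℝ) := fun N => by exact_mod_cast Nat.succ_pos N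
  -- eventually `(N+1)^{p-q} > M`
  have hev : ∀ᶠ N : ℕ in atTop, M < ((N + 1 : ℕ) : ℝ) ^ (p - q) :=
    (TailsVmax.tendsto_natSucc_rpow_atTop hpq).eventually_gt_atTop M
  -- deterministic inclusion, eventually in `N`
  have hincl : ∀ᶠ N : ℕ in atTop, {z | ((N + 1 : ℕ) : ℝ) ^ p < vmaxInt σ N (Φ N) t z} ⊆
      {z | Cexp < ∫ s in Icc 0 t, ∫ y, Real.exp (lam * ‖y.2‖ ^ 2) ∂(empiricalMeasure ((Φ N).flow s z))} ∪
        (Φ N).goodᶜ := by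
    filter_upwards [hev] with N hN z hz
    simp only [mem_setOf_eq] at hz
    by_contra hnot
    simp only [mem_union, mem_compl_iff, mem_setOf_eq, not_or, not_lt, not_not] at hnot
    obtain ⟨hzH, hzg⟩ := hnot
    rw [PastDamping.tails_integral_eq] at hzH
    have h1 := TailsVmax.vmaxInt_le hlam hq hq1 (Φ N) hzg ht.le
    have hNq : 1 ≤ ((N + 1 : ℕ) : ℝ) ^ q :=
      Real.one_le_rpow (by exact_mod_cast Nat.succ_le_succ (Nat.zero_le N)) hq.le
    have hNq0 : 0 ≤ ((N + 1 : ℕ) : ℝ) ^ q := Real.rpow_nonneg (hpos N).le q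
    have h2 : vmaxInt σ N (Φ N) t z ≤ M * ((N + 1 : ℕ) : ℝ) ^ q := by
      have hI : ∫ s in Icc 0 t, PastDamping.expMoment lam N ((Φ N).flow s z) ≤ max Cexp 0 :=
        hzH.trans (le_max_left _ _)
      have hBN : 0 ≤ B * ((N + 1 : ℕ) : ℝ) ^ q := mul_nonneg hB hNq0
      have h128 : 0 ≤ 128 * t := by positivity
      have hC0 : 0 ≤ max Cexp 0 := le_max_right _ _
      calc vmaxInt σ N (Φ N) t z ≤ 128 * t + B * ((N + 1 : ℕ) : ℝ) ^ q *
            ∫ s in Icc 0 t, PastDamping.expMoment lam N ((Φ N).flow s z) := h1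
        _ ≤ 128 * t + B * ((N + 1 : ℕ) : ℝ) ^ q * max Cexp 0 := by
            have := mul_le_mul_of_nonneg_left hI hBN
            linarith
        _ ≤ 128 * t * ((N + 1 : ℕ) : ℝ) ^ q + B * max Cexp 0 * ((N + 1 : ℕ) : ℝ) ^ q := by
            have h3 : 128 * t * 1 ≤ 128 * t * ((N + 1 : ℕ) : ℝ) ^ q := mul_le_mul_of_nonneg_left hNq h128
            have h4 : B * ((N + 1 : ℕ) : ℝ) ^ q * max Cexp 0 =
                B * max Cexp 0 * ((N + 1 : ℕ) : ℝ) ^ q := by ring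
            rw [h4]
            linarith
        _ = M * ((N + 1 : ℕ) : ℝ) ^ q := by rw [hM_def]; ring
    have h3 : M * ((N + 1 : ℕ) : ℝ) ^ q < ((N + 1 : ℕ) : ℝ) ^ p := by
      have hNqp : 0 < ((N + 1 : ℕ) : ℝ) ^ q := Real.rpow_pos_of_pos (hpos N) q
      calc M * ((N + 1 : ℕ) : ℝ) ^ q < ((N + 1 : ℕ) : ℝ) ^ (p - q) * ((N + 1 : ℕ) : ℝ) ^ q :=
            mul_lt_mul_of_pos_right hN hNqp
        _ = ((N + 1 : ℕ) : ℝ) ^ p := by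
            rw [← Real.rpow_add (hpos N)]
            congr 1
            ring
    linarith
  -- measure bound, eventually in `N`
  have hle : ∀ᶠ N : ℕ in atTop,
      localGibbsLaw σ a₀ u₀ θ₀ N (Φ N) {z | ((N + 1 : ℕ) : ℝ) ^ p < vmaxInt σ N (Φ N) t z} ≤
        localGibbsLaw σ a₀ u₀ θ₀ N (Φ N)
          {z | Cexp < ∫ s in Icc 0 t, ∫ y, Real.exp (lam * ‖y.2‖ ^ 2) ∂(empiricalMeasure ((Φ N).flow s z))} := by
    filter_upwards [hincl] with N hN
    calc localGibbsLaw σ a₀ u₀ θ₀ N (Φ N) {z | ((N + 1 : ℕ) : ℝ) ^ p < vmaxInt σ N (Φ N) t z}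
        ≤ localGibbsLaw σ a₀ u₀ θ₀ N (Φ N)
            ({z | Cexp < ∫ s in Icc 0 t, ∫ y, Real.exp (lam * ‖y.2‖ ^ 2)
              ∂(empiricalMeasure ((Φ N).flow s z))} ∪ (Φ N).goodᶜ) := measure_mono hN
      _ ≤ localGibbsLaw σ a₀ u₀ θ₀ N (Φ N)
            {z | Cexp < ∫ s in Icc 0 t, ∫ y, Real.exp (lam * ‖y.2‖ ^ 2)
              ∂(empiricalMeasure ((Φ N).flow s z))} +
          localGibbsLaw σ a₀ u₀ θ₀ N (Φ N) (Φ N).goodᶜ := measure_union_le _ _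
      _ = _ := by
          rw [localGibbsLaw_absolutelyContinuous σ a₀ u₀ θ₀ N (Φ N) (Φ N).measure_compl_good, add_zero]
  exact tendsto_of_tendsto_of_tendsto_of_le_of_le' tendsto_const_nhds hH2
    (Eventually.of_forall fun N => bot_le) hle

end

end Summit.AtomisticToContinuum.HydrodynamicLimit.Theorems.ContactBalance
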